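import Summits.BirchSwinnertonDyer.BirchSwinnertonDyer.Theorems.KolyvaginRoadThreeClassCertificate
import Summits.BirchSwinnertonDyer.Rank1Residual.X11b.Three.KolyvaginNonvanishing
import Summits.BirchSwinnertonDyer.Rank1Residual.X11b.Three.KolyvaginH44AtThree
import HarnessLib

/-!
# Route `KolyvaginRoadThree`, crux `ZhangSharpFrameAtThree` (item stmt-BirchSwinnertonDyer-19153):
# the crux IS the tower point form, MODULO the seam G-a at every level (cell `bsd-stepL`, seat
# `bsd-stepL-zhang3-p1`; `--supports 19153`, helper)

THEOREMS ONLY (no definition, no named fact, no `sorry`); nothing about Kolyvagin's conjecture at `p = 3`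
is asserted; the seam is a HYPOTHESIS SHAPE (as `hKD` in `Koly.bsdp_three_onA1_of_kolyvaginFrames`,
p410690), nothing is asserted about it either; nothing is booked.

`KolyCert.zhangSharpFrameAtThree_of_towerCertificates` (`Theorems/KolyvaginRoadThreePointCertificate.lean`)
derives the crux from the pure point statement «at every Manin-good conductor-1 frame some tower of
Kolyvagin–Heegner data `d m (m ∣ n)` over a level `n ∈ Λ₃` has `3 ∤ P(n)` in `E(K[n])`».  The converse
needs Kolyvagin–Heegner data at the LOWER levels `m ∣ n`, which the crux (an `∃ d` at level `n` only) does
not provide: their existence is CM theory — *"the point `x_m` is rational over `K_m`"* (Gross 1991, §3;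
Gross 1984, §3), the seam G-a of `plan/K2KOLY/DESIGN.md` §3 AT LEVEL `m` (the support item 19156 / koly's
`exists_kolyvaginHeegnerData_one` carry it at `m = 1` only).  Here:

* `KolyCert.towerCertificates_of_zhangSharpFrameAtThree` — under the level-`m` seam `hKD` (hypothesis
  shape: `Nonempty (KolyvaginHeegnerData Dt β ι m)` for `K` imaginary quadratic Heegner, `4N ∣ β² − d_K`,
  `m` square-free with prime factors inert in `K`), the crux IMPLIES the tower point form (the top datum is
  the crux's, the lower data are the seam's; `3 ∤ P(n)` from `c₁(n) ≠ 0` by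
  `Koly.not_pDiv_of_kolyvaginClass_ne_zero`);
* with `KolyCert.zhangSharpFrameAtThree_of_towerCertificates` (`Theorems/KolyvaginRoadThreePointCertificate.lean`,
  p418676) this gives, under `hKD`, **crux ⟺ tower point form** (the `Iff` is the pair of the two theorems;
  it is not restated here so that this file does not import that module);
* `KolyCert.discr_ne_neg_three_of_frame` — remark: the crux's binder `d_K ≠ −3` is implied by the others
  (multiplicative `3`, Heegner hypothesis, orientation) — idle.

References (locators only): [cite: GrossLMS1991, §3 (x_n rational over K_n), §4 (4.1), Cor. 4.5 via McCallum]
[cite: McCallumLMS1991, Cor. 4.5] [cite: Gross1984HeegnerPoints, §3].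
-/

noncomputable section

open scoped Classical
open WeierstrassCurve Field NumberField IsDedekindDomain
open Literature.NumberTheory.EllipticCurves
open Literature.NumberTheory.EllipticCurves.KolyvaginCocycle
open Literature.NumberTheory.EllipticCurves.ModularForms
open Summit.BirchSwinnertonDyer.Rank1Residual.X11b.Three.Koly

namespace Summit.BirchSwinnertonDyer.Rank1Residual.X11b.Three.KolyCert

/-- **Crux ⇒ tower point form, modulo the seam G-a at every level.**  Assume (hypothesis shape `hKD`,
CM rationality of `x_m`, Gross 1991 §3 — NOT asserted): for `K` imaginary quadratic with the Heegner
hypothesis for `N_E`, every frame `(Dt, β, ι)` with `4N ∣ β² − d_K` and every square-free `m` whose prime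
factors are inert in `K`, a Kolyvagin–Heegner datum of conductor `m` EXISTS.  Then
`Theses.KolyvaginRoadThree.ZhangSharpFrameAtThree` gives, at every Manin-good conductor-1 frame on the
crux's binders, a level `n ∈ Λ₃` and a TOWER `d m (m ∣ n)` with `3 ∤ P(n)` in `E(K[n])` — the top datum
is the crux's own (so `3 ∤ P(n)` is `Koly.not_pDiv_of_kolyvaginClass_ne_zero`), the lower data are the
seam's. [cite: GrossLMS1991, §3 and §4 (4.1)] [cite: McCallumLMS1991, Cor. 4.5] -/
theorem towerCertificates_of_zhangSharpFrameAtThree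
    (hKD : ∀ (W : WeierstrassCurve ℚ) [W.IsElliptic] [W.IsGloballyMinimal] [NeZero (W.conductorNorm ℤ)]
      (K : Type) [Field K] [NumberField K]
      (Dt : ModularParametrizationData W (W.conductorNorm ℤ)) (β : ℤ) (ι : K →+* ℂ) (m : ℕ),
      IsImaginaryQuadratic K → SatisfiesHeegnerHypothesis (W.conductorNorm ℤ) K →
      (4 * (W.conductorNorm ℤ : ℤ)) ∣ β ^ 2 - NumberField.discr K → Squarefree m →
      (∀ q ∈ m.primeFactors, (Ideal.span {(q : 𝓞 K)}).IsPrime) →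
      Nonempty (KolyvaginHeegnerData Dt β ι m))
    (hZ : Summit.BirchSwinnertonDyer.BirchSwinnertonDyer.Theses.KolyvaginRoadThree.ZhangSharpFrameAtThree) :
    ∀ (W : WeierstrassCurve ℚ) [W.IsElliptic] [W.IsGloballyMinimal] [NeZero (W.conductorNorm ℤ)]
      (K : Type) [Field K] [NumberField K]
      (Dt : ModularParametrizationData W (W.conductorNorm ℤ)) (β : ℤ) (ι : K →+* ℂ),
      W.HasMultiplicativeReductionAtPrime 3 → Rank1Residual.Surj W 3 → Rank1Residual.Ram W 3 →
      ¬ 3 ∣ W.tamagawaProduct → IsImaginaryQuadratic K →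
      SatisfiesHeegnerHypothesis (W.conductorNorm ℤ) K → NumberField.discr K ≠ -3 →
      (4 * (W.conductorNorm ℤ : ℤ)) ∣ β ^ 2 - NumberField.discr K → ¬ (3 : ℤ) ∣ Dt.c →
      ∃ (n : ℕ) (d : (m : ℕ) → m ∣ n → KolyvaginHeegnerData Dt β ι m),
        KolyvaginDescent.KolSupp (Zhang2014.IsKolyvaginPrime (W.conductorNorm ℤ) W K 3) n ∧
          ¬ PDiv (d n dvd_rfl) 3 1 := by
  intro W _ _ _ K _ _ Dt β ι hmult hsurj hram htam hK hH h3 hβ hc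
  obtain ⟨n, dn, hn, hne⟩ := hZ W K Dt β ι hmult hsurj hram htam hK hH h3 hβ hc
  -- the seam supplies data at every square-free inert level; the crux's datum sits on top
  have hinert : ∀ m : ℕ, m ∣ n → ∀ q ∈ m.primeFactors, (Ideal.span {(q : 𝓞 K)}).IsPrime :=
    fun m hm q hq ↦ (hn.2 q (Nat.primeFactors_mono hm hn.1.ne_zero hq)).2.2.2.2.1
  let d : (m : ℕ) → m ∣ n → KolyvaginHeegnerData Dt β ι m := fun m hm ↦
    if h : m = n then h ▸ dn
    else Classical.choice (hKD W K Dt β ι m hK hH hβ (hn.1.squarefree_of_dvd hm) (hinert m hm))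
  have hdn : d n dvd_rfl = dn := by
    show (if h : n = n then h ▸ dn else _) = dn
    rw [dif_pos rfl]
  refine ⟨n, d, hn, ?_⟩
  rw [hdn]
  exact not_pDiv_of_kolyvaginClass_ne_zero dn hne

/-! ## Remark: the binder `d_K ≠ −3` of the crux is idle -/

/-- **The crux's binder `NumberField.discr K ≠ -3` is implied by its other binders**: multiplicative
reduction at `3` gives `3 ∣ N` (`dvd_conductorNorm_iff_not_hasGoodReductionAtPrime`), the Heegner
hypothesis gives `(N, d_K) = 1` (`SatisfiesHeegnerHypothesis.coprime_discr`), and with the frame's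
orientation `4N ∣ β² − d_K` the tree's `Three.discr_lt_neg_four_of_isCoprime_of_dvd_sq_sub` gives
`d_K < −4`. (Bookkeeping for the planner: the binder can be dropped at the next statement edit; nothing
else is asserted.) [folklore] -/
theorem discr_ne_neg_three_of_frame (W : WeierstrassCurve ℚ) [W.IsElliptic] [W.IsGloballyMinimal]
    [NeZero (W.conductorNorm ℤ)] (K : Type) [Field K] [NumberField K] (β : ℤ)
    (hmult : W.HasMultiplicativeReductionAtPrime 3) (hK : IsImaginaryQuadratic K)
    (hH : SatisfiesHeegnerHypothesis (W.conductorNorm ℤ) K)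
    (hβ : (4 * (W.conductorNorm ℤ : ℤ)) ∣ β ^ 2 - NumberField.discr K) :
    NumberField.discr K ≠ -3 := by
  haveI : Fact (Nat.Prime 3) := ⟨Nat.prime_three⟩
  have hND : IsCoprime (W.conductorNorm ℤ : ℤ) (NumberField.discr K) := by
    have h := Literature.SatisfiesHeegnerHypothesis.coprime_discr hK.1 hH
    refine Int.isCoprime_iff_gcd_eq_one.mpr ?_
    rw [Int.gcd_eq_natAbs, Int.natAbs_natCast]
    exact h
  have h3 : 3 ∣ W.conductorNorm ℤ :=
    (W.dvd_conductorNorm_iff_not_hasGoodReductionAtPrime 3).mpr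
      (WeierstrassCurve.HasMultiplicativeReduction.not_hasGoodReduction (R := ℤ_[3]) hmult)
  have hD : NumberField.discr K < -4 := discr_lt_neg_four_of_isCoprime_of_dvd_sq_sub hK hND h3 hβ
  omega

end Summit.BirchSwinnertonDyer.Rank1Residual.X11b.Three.KolyCert

end
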